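import Summits.QuantumFields.YangMills.Theorems.UnitScaleTiltProp7B8Prop7Plaq
import Summits.QuantumFields.BalabanUV.T4Continuum.Support.TermwiseBackground
import HarnessLib

/-!
# Route `UnitScaleTilt`, crux K1 child «MinimiserStabilityRegPr» (stmt-QuantumFields-19200), registered stub `stub_prop7From14` (skeleton birth_v7
# cc37a178…; leaf V3) — pillar P-V3-CDE, row (D), divergence clause: THE SECOND-ORDER LIPSCHITZ ESTIMATES FOR THE EXPONENTIAL CHART it needs —
# `‖e^A − e^B − (A − B)‖ ≤ (e^r − 1)‖A − B‖` on the `r`-ball of a Banach algebra, and for the four-factor plaquette function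
# `f(Z) = e^{iZ₁}e^{iZ₂}e^{−iZ₃}e^{−iZ₄} − 1 − i(Z₁ + Z₂ − Z₃ − Z₄)` of Hermitian `2 × 2` matrices: `‖f(A) − f(B)‖ ≤ 11 r Σⱼ‖Aⱼ − Bⱼ‖` (`r ≤ ¼`)

Cell `ym3-torus`, width seat `ym-ust-19200-w2` (gen 0; D-0149; OWNER RULING g24-№1 A2′: v8 row (D) = [Balaban1985RegularSpaces] Prop. 7 at the T³ carrier).  YM₃ on T³ is a
ladder rung (R3), not the Clay problem; nothing here is a claim about the crux, d = 4 or the mass gap.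

WHY.  The divergence clause of row (D) (`Prop7PV3CDERowD`, hypothesis `hdiv`) bounds the covariant divergence `D*_{U}∂U` of `U = U₁U₀`, `U₁ = e^{iX}` in (19): the
nonlinear part `N = (∂_{U₀}U₁)(p) − 1 − i(D_{U₀}X)(p)` of [Balaban1985RegularSpaces] (1.47) is only `O(ε₂²η²)` in norm, so its COVARIANT DIFFERENCE between
neighbouring plaquettes must be estimated through the Lipschitz constant of `f` on the `ε₂η`-ball (`O(ε₂η)`) times the covariant differences of the exponents
(`O(ε₂η²)` by (19)), giving the required `O(ε₂²η³)`.  THIS FILE supplies exactly these two analytic lemmas (no lattice).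

WHAT IS PROVED (sorry-free, no definition), in `M₂(ℂ)` (operator norm; `e^{iZ}` unitary for Hermitian `Z`): `norm_exp_I_smul_le_one`,
`norm_exp_I_smul_sub_exp_I_smul_sub_le` (from the tree's Banach-algebra lemma `TermwiseBackground.norm_exp_sub_exp_sub_le`), the sandwich lemma
`norm_mul_mul_sub_le_of_near_one`, `norm_mul_near_one`, the telescoping identity `tel4`, and **`norm_plaq4_sub_plaq4_le`**: `‖f(A) − f(B)‖ ≤ 11 r (Σⱼ ‖Aⱼ − Bⱼ‖)`
for Hermitian `Aⱼ, Bⱼ` of norm `≤ r ≤ ¼`.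

HONEST SCOPE.  Elementary Banach-algebra estimates ([folklore]); cited to the printed step they serve ((1.47) p. 84: «a remainder is O₁((1/2!)η²(∂|A|(p))²)»).
Count-neutral helper toward stmt-QuantumFields-19200 (`--supports`), not a proof of the stub.

References: T. Bałaban, CMP 99 (1985) 75–102 [Balaban1985RegularSpaces] ((1.47) p.84, Prop. 7 p.98); CMP 98 (1985) 17–51 [Balaban1985Averaging] ((24) p.21).
-/

noncomputable section

namespace Summit.QuantumFields.YangMills.Theorems.Prop7ExpLipschitz

open Literature.MathematicalPhysics.QuantumFieldTheory.Balaban1983to89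
open Summit.QuantumFields.YangMills.Theorems.Prop7B8Prop7Plaq (norm_exp_I_smul_sub_one_le')
open NormedSpace

/-! ## §1 The four-factor plaquette function of Hermitian `2 × 2` matrices

The Banach-algebra input `‖e^A − e^B − (A − B)‖ ≤ (e^r − 1)‖A − B‖` is the tree's
`Summit.QuantumFields.BalabanUV.T4Continuum.TermwiseBackground.norm_exp_sub_exp_sub_le` (imported, not restated); `‖e^{iZ} − 1‖ ≤ ‖Z‖` is
`Prop7B8Prop7Plaq.norm_exp_I_smul_sub_one_le'`. -/



section Plaq4

open scoped Matrix.Norms.L2Operator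

/-- `e^{iZ}` is unitary for Hermitian `Z`, hence `‖e^{iZ}‖ ≤ 1`. [cite: Balaban1985Averaging, (24) p.21] -/
theorem norm_exp_I_smul_le_one {Z : Matrix (Fin 2) (Fin 2) ℂ} (hZ : Z.IsHermitian) : ‖exp (Complex.I • Z)‖ ≤ 1 := by
  letI : CStarAlgebra (Matrix (Fin 2) (Fin 2) ℂ) := B10Eq29TubeLine.cstarAlgebraMatrix 2
  exact B8Ineq170.cstar_unitary_norm_le_one (B8Ineq170.exp_I_smul_mem_unitary hZ.isSelfAdjoint)

/-- The second-order Lipschitz bound for `Z ↦ e^{iZ}`: `‖e^{iA} − e^{iB} − i(A − B)‖ ≤ (e^r − 1)‖A − B‖` for `‖A‖, ‖B‖ ≤ r`. [folklore] -/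
theorem norm_exp_I_smul_sub_exp_I_smul_sub_le {A B : Matrix (Fin 2) (Fin 2) ℂ} {r : ℝ} (hA : ‖A‖ ≤ r) (hB : ‖B‖ ≤ r) :
    ‖exp (Complex.I • A) - exp (Complex.I • B) - Complex.I • (A - B)‖ ≤ (Real.exp r - 1) * ‖A - B‖ := by
  have hA' : ‖Complex.I • A‖ ≤ r := by rwa [norm_smul, Complex.norm_I, one_mul]
  have hB' : ‖Complex.I • B‖ ≤ r := by rwa [norm_smul, Complex.norm_I, one_mul]
  have h := Summit.QuantumFields.BalabanUV.T4Continuum.TermwiseBackground.norm_exp_sub_exp_sub_le hA' hB'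
  rwa [← smul_sub, norm_smul, Complex.norm_I, one_mul] at h

/-- THE SANDWICH LEMMA: `‖P Δ S − Λ‖ ≤ ρ + (p + s)δ` when `‖P‖, ‖S‖ ≤ 1`, `‖P − 1‖ ≤ p`, `‖S − 1‖ ≤ s`, `‖Δ‖ ≤ δ`, `‖Δ − Λ‖ ≤ ρ`
(`PΔS − Λ = (P − 1)ΔS + Δ(S − 1) + (Δ − Λ)`; `‖P‖ ≤ 1` is not even needed). [folklore] -/
theorem norm_mul_mul_sub_le_of_near_one {P Δ S Λ : Matrix (Fin 2) (Fin 2) ℂ} {p s δ ρ : ℝ}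
    (hS : ‖S‖ ≤ 1) (hP1 : ‖P - 1‖ ≤ p) (hS1 : ‖S - 1‖ ≤ s) (hΔ : ‖Δ‖ ≤ δ) (hρ : ‖Δ - Λ‖ ≤ ρ) :
    ‖P * Δ * S - Λ‖ ≤ ρ + (p + s) * δ := by
  have hδ0 : 0 ≤ δ := (norm_nonneg _).trans hΔ
  have hp0 : 0 ≤ p := (norm_nonneg _).trans hP1
  have e : P * Δ * S - Λ = (P - 1) * Δ * S + Δ * (S - 1) + (Δ - Λ) := by noncomm_ring
  rw [e]
  have n1 : ‖(P - 1) * Δ * S‖ ≤ p * δ * 1 :=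
    (norm_mul_le _ _).trans (mul_le_mul ((norm_mul_le _ _).trans (mul_le_mul hP1 hΔ (norm_nonneg _) hp0)) hS (norm_nonneg _) (by positivity))
  have n2 : ‖Δ * (S - 1)‖ ≤ δ * s := (norm_mul_le _ _).trans (mul_le_mul hΔ hS1 (norm_nonneg _) hδ0)
  calc _ ≤ ‖(P - 1) * Δ * S‖ + ‖Δ * (S - 1)‖ + ‖Δ - Λ‖ := (norm_add_le _ _).trans (add_le_add (norm_add_le _ _) le_rfl)
    _ ≤ p * δ * 1 + δ * s + ρ := add_le_add (add_le_add n1 n2) hρ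
    _ = ρ + (p + s) * δ := by ring

/-- Products of two contractions near `1`: `‖EF‖ ≤ 1` and `‖EF − 1‖ ≤ ‖E − 1‖ + ‖F − 1‖`. [folklore] -/
theorem norm_mul_near_one {E F : Matrix (Fin 2) (Fin 2) ℂ} (hE : ‖E‖ ≤ 1) (hF : ‖F‖ ≤ 1) :
    ‖E * F‖ ≤ 1 ∧ ‖E * F - 1‖ ≤ ‖E - 1‖ + ‖F - 1‖ := by
  refine ⟨(norm_mul_le _ _).trans (by nlinarith [norm_nonneg E, norm_nonneg F]), ?_⟩
  have e : E * F - 1 = (E - 1) * F + (F - 1) := by noncomm_ring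
  rw [e]
  calc _ ≤ ‖(E - 1) * F‖ + ‖F - 1‖ := norm_add_le _ _
    _ ≤ ‖E - 1‖ * ‖F‖ + ‖F - 1‖ := add_le_add (norm_mul_le _ _) le_rfl
    _ ≤ ‖E - 1‖ * 1 + ‖F - 1‖ := by gcongr
    _ = _ := by ring

/-- The telescoping identity behind the four-factor Lipschitz bound (any ring). [folklore] -/
theorem tel4 {R : Type*} [Ring R] (E₁ E₂ E₃ E₄ F₁ F₂ F₃ F₄ a₁ a₂ a₃ a₄ b₁ b₂ b₃ b₄ : R) :
    (E₁ * E₂ * E₃ * E₄ - 1 - (a₁ + a₂ - a₃ - a₄)) - (F₁ * F₂ * F₃ * F₄ - 1 - (b₁ + b₂ - b₃ - b₄))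
      = (1 * (E₁ - F₁) * (E₂ * (E₃ * E₄)) - (a₁ - b₁))
        + (F₁ * (E₂ - F₂) * (E₃ * E₄) - (a₂ - b₂))
        + (F₁ * F₂ * (E₃ - F₃) * E₄ - (-(a₃ - b₃)))
        + (F₁ * F₂ * F₃ * (E₄ - F₄) * 1 - (-(a₄ - b₄))) := by
  noncomm_ring

/-- **THE LIPSCHITZ BOUND FOR THE FOUR-FACTOR PLAQUETTE FUNCTION** `f(Z) = e^{iZ₁}e^{iZ₂}e^{−iZ₃}e^{−iZ₄} − 1 − i(Z₁ + Z₂ − Z₃ − Z₄)` on Hermitian `2 × 2` matrices of norm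
`≤ r ≤ ¼`: `‖f(A) − f(B)‖ ≤ 11 r (‖A₁ − B₁‖ + ‖A₂ − B₂‖ + ‖A₃ − B₃‖ + ‖A₄ − B₄‖)` — `f` vanishes to second order, so its Lipschitz constant on the `r`-ball is `O(r)`
(telescoping the product, `‖e^{iA} − e^{iB} − i(A − B)‖ ≤ (e^r − 1)‖A − B‖ ≤ 2r‖A − B‖`, and the sandwich lemma with `‖prefix − 1‖, ‖suffix − 1‖ ≤ 3r`).  This is the
Lipschitz form of [Balaban1985RegularSpaces] (1.47)'s remainder «O₁((1/2!)η²(∂|A|(p))²)». [cite: Balaban1985RegularSpaces, (1.47) p.84] -/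
theorem norm_plaq4_sub_plaq4_le {A₁ A₂ A₃ A₄ B₁ B₂ B₃ B₄ : Matrix (Fin 2) (Fin 2) ℂ} {r : ℝ} (hr : r ≤ 1 / 4)
    (hA₁ : A₁.IsHermitian) (hA₂ : A₂.IsHermitian) (hA₃ : A₃.IsHermitian) (hA₄ : A₄.IsHermitian)
    (hB₁ : B₁.IsHermitian) (hB₂ : B₂.IsHermitian) (hB₃ : B₃.IsHermitian) (hB₄ : B₄.IsHermitian)
    (nA₁ : ‖A₁‖ ≤ r) (nA₂ : ‖A₂‖ ≤ r) (nA₃ : ‖A₃‖ ≤ r) (nA₄ : ‖A₄‖ ≤ r) (nB₁ : ‖B₁‖ ≤ r) (nB₂ : ‖B₂‖ ≤ r) (nB₃ : ‖B₃‖ ≤ r) (nB₄ : ‖B₄‖ ≤ r) :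
    ‖(exp (Complex.I • A₁) * exp (Complex.I • A₂) * exp (Complex.I • (-A₃)) * exp (Complex.I • (-A₄)) - 1 - Complex.I • (A₁ + A₂ - A₃ - A₄))
      - (exp (Complex.I • B₁) * exp (Complex.I • B₂) * exp (Complex.I • (-B₃)) * exp (Complex.I • (-B₄)) - 1 - Complex.I • (B₁ + B₂ - B₃ - B₄))‖
      ≤ 11 * r * (‖A₁ - B₁‖ + ‖A₂ - B₂‖ + ‖A₃ - B₃‖ + ‖A₄ - B₄‖) := by
  have hr0 : 0 ≤ r := (norm_nonneg _).trans nA₁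
  have hr1 : r ≤ 1 := hr.trans (by norm_num)
  have her : Real.exp r - 1 ≤ 2 * r := by
    have h := Real.abs_exp_sub_one_sub_id_le (x := r) (by rwa [abs_of_nonneg hr0])
    have h' : Real.exp r - 1 - r ≤ r ^ 2 := (le_abs_self _).trans h
    nlinarith
  -- the eight unitary factors
  set E₁ := exp (Complex.I • A₁); set E₂ := exp (Complex.I • A₂); set E₃ := exp (Complex.I • (-A₃)); set E₄ := exp (Complex.I • (-A₄))
  set F₁ := exp (Complex.I • B₁); set F₂ := exp (Complex.I • B₂); set F₃ := exp (Complex.I • (-B₃)); set F₄ := exp (Complex.I • (-B₄))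
  have uE₁ : ‖E₁‖ ≤ 1 := norm_exp_I_smul_le_one hA₁
  have uE₂ : ‖E₂‖ ≤ 1 := norm_exp_I_smul_le_one hA₂
  have uE₃ : ‖E₃‖ ≤ 1 := norm_exp_I_smul_le_one hA₃.neg
  have uE₄ : ‖E₄‖ ≤ 1 := norm_exp_I_smul_le_one hA₄.neg
  have uF₁ : ‖F₁‖ ≤ 1 := norm_exp_I_smul_le_one hB₁
  have uF₂ : ‖F₂‖ ≤ 1 := norm_exp_I_smul_le_one hB₂
  have uF₃ : ‖F₃‖ ≤ 1 := norm_exp_I_smul_le_one hB₃.neg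
  have uF₄ : ‖F₄‖ ≤ 1 := norm_exp_I_smul_le_one hB₄.neg
  have oE₂ : ‖E₂ - 1‖ ≤ r := (norm_exp_I_smul_sub_one_le' hA₂).trans nA₂
  have oE₃ : ‖E₃ - 1‖ ≤ r := (norm_exp_I_smul_sub_one_le' hA₃.neg).trans (by rw [norm_neg]; exact nA₃)
  have oE₄ : ‖E₄ - 1‖ ≤ r := (norm_exp_I_smul_sub_one_le' hA₄.neg).trans (by rw [norm_neg]; exact nA₄)
  have oF₁ : ‖F₁ - 1‖ ≤ r := (norm_exp_I_smul_sub_one_le' hB₁).trans nB₁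
  have oF₂ : ‖F₂ - 1‖ ≤ r := (norm_exp_I_smul_sub_one_le' hB₂).trans nB₂
  have oF₃ : ‖F₃ - 1‖ ≤ r := (norm_exp_I_smul_sub_one_le' hB₃.neg).trans (by rw [norm_neg]; exact nB₃)
  -- the four differences and their linear parts
  set d₁ := ‖A₁ - B₁‖; set d₂ := ‖A₂ - B₂‖; set d₃ := ‖A₃ - B₃‖; set d₄ := ‖A₄ - B₄‖
  have ρ₁ : ‖E₁ - F₁ - Complex.I • (A₁ - B₁)‖ ≤ 2 * r * d₁ :=
    (norm_exp_I_smul_sub_exp_I_smul_sub_le nA₁ nB₁).trans (mul_le_mul_of_nonneg_right her (norm_nonneg _))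
  have ρ₂ : ‖E₂ - F₂ - Complex.I • (A₂ - B₂)‖ ≤ 2 * r * d₂ :=
    (norm_exp_I_smul_sub_exp_I_smul_sub_le nA₂ nB₂).trans (mul_le_mul_of_nonneg_right her (norm_nonneg _))
  have ρ₃ : ‖E₃ - F₃ - Complex.I • (-(A₃ - B₃))‖ ≤ 2 * r * d₃ := by
    have h := norm_exp_I_smul_sub_exp_I_smul_sub_le (A := -A₃) (B := -B₃) (r := r) (by rw [norm_neg]; exact nA₃) (by rw [norm_neg]; exact nB₃)
    rw [show -A₃ - -B₃ = -(A₃ - B₃) by abel, norm_neg] at h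
    exact h.trans (mul_le_mul_of_nonneg_right her (norm_nonneg _))
  have ρ₄ : ‖E₄ - F₄ - Complex.I • (-(A₄ - B₄))‖ ≤ 2 * r * d₄ := by
    have h := norm_exp_I_smul_sub_exp_I_smul_sub_le (A := -A₄) (B := -B₄) (r := r) (by rw [norm_neg]; exact nA₄) (by rw [norm_neg]; exact nB₄)
    rw [show -A₄ - -B₄ = -(A₄ - B₄) by abel, norm_neg] at h
    exact h.trans (mul_le_mul_of_nonneg_right her (norm_nonneg _))
  have δ_of : ∀ {Δ Λ : Matrix (Fin 2) (Fin 2) ℂ} {d : ℝ}, ‖Λ‖ = d → ‖Δ - Λ‖ ≤ 2 * r * d → ‖Δ‖ ≤ (1 + 2 * r) * d := by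
    intro Δ Λ d hΛ hρ
    have := norm_le_norm_sub_add Δ Λ   -- ‖Δ‖ ≤ ‖Δ - Λ‖ + ‖Λ‖
    linarith
  have nΛ : ∀ (M : Matrix (Fin 2) (Fin 2) ℂ), ‖Complex.I • M‖ = ‖M‖ := fun M => by rw [norm_smul, Complex.norm_I, one_mul]
  have δ₁ : ‖E₁ - F₁‖ ≤ (1 + 2 * r) * d₁ := δ_of (nΛ _) ρ₁
  have δ₂ : ‖E₂ - F₂‖ ≤ (1 + 2 * r) * d₂ := δ_of (nΛ _) ρ₂
  have δ₃ : ‖E₃ - F₃‖ ≤ (1 + 2 * r) * d₃ := δ_of (by rw [nΛ, norm_neg]) ρ₃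
  have δ₄ : ‖E₄ - F₄‖ ≤ (1 + 2 * r) * d₄ := δ_of (by rw [nΛ, norm_neg]) ρ₄
  -- telescoping
  have tel := tel4 E₁ E₂ E₃ E₄ F₁ F₂ F₃ F₄ (Complex.I • A₁) (Complex.I • A₂) (Complex.I • A₃) (Complex.I • A₄)
    (Complex.I • B₁) (Complex.I • B₂) (Complex.I • B₃) (Complex.I • B₄)
  simp only [← smul_add, ← smul_sub, ← smul_neg] at tel
  rw [tel]
  -- prefixes and suffixes
  have pre2 := norm_mul_near_one uF₁ uF₂                        -- F₁F₂
  have pre3 := norm_mul_near_one pre2.1 uF₃                      -- F₁F₂F₃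
  have suf2 := norm_mul_near_one uE₃ uE₄                        -- E₃E₄
  have suf3 := norm_mul_near_one uE₂ suf2.1                      -- E₂(E₃E₄)
  have t₁ : ‖1 * (E₁ - F₁) * (E₂ * (E₃ * E₄)) - Complex.I • (A₁ - B₁)‖ ≤ 2 * r * d₁ + (0 + 3 * r) * ((1 + 2 * r) * d₁) :=
    norm_mul_mul_sub_le_of_near_one suf3.1 (by simp) (by linarith [suf3.2, suf2.2]) δ₁ ρ₁
  have t₂ : ‖F₁ * (E₂ - F₂) * (E₃ * E₄) - Complex.I • (A₂ - B₂)‖ ≤ 2 * r * d₂ + (r + 2 * r) * ((1 + 2 * r) * d₂) :=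
    norm_mul_mul_sub_le_of_near_one suf2.1 oF₁ (by linarith [suf2.2]) δ₂ ρ₂
  have t₃ : ‖F₁ * F₂ * (E₃ - F₃) * E₄ - Complex.I • (-(A₃ - B₃))‖ ≤ 2 * r * d₃ + (2 * r + r) * ((1 + 2 * r) * d₃) :=
    norm_mul_mul_sub_le_of_near_one uE₄ (by linarith [pre2.2]) oE₄ δ₃ ρ₃
  have t₄ : ‖F₁ * F₂ * F₃ * (E₄ - F₄) * 1 - Complex.I • (-(A₄ - B₄))‖ ≤ 2 * r * d₄ + (3 * r + 0) * ((1 + 2 * r) * d₄) :=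
    norm_mul_mul_sub_le_of_near_one (by simp) (by linarith [pre3.2, pre2.2]) (by simp) δ₄ ρ₄
  have hd₁ : 0 ≤ d₁ := norm_nonneg _
  have hd₂ : 0 ≤ d₂ := norm_nonneg _
  have hd₃ : 0 ≤ d₃ := norm_nonneg _
  have hd₄ : 0 ≤ d₄ := norm_nonneg _
  calc _ ≤ ‖1 * (E₁ - F₁) * (E₂ * (E₃ * E₄)) - Complex.I • (A₁ - B₁)‖ + ‖F₁ * (E₂ - F₂) * (E₃ * E₄) - Complex.I • (A₂ - B₂)‖
          + ‖F₁ * F₂ * (E₃ - F₃) * E₄ - Complex.I • (-(A₃ - B₃))‖ + ‖F₁ * F₂ * F₃ * (E₄ - F₄) * 1 - Complex.I • (-(A₄ - B₄))‖ := by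
        refine (norm_add_le _ _).trans (add_le_add ((norm_add_le _ _).trans (add_le_add ((norm_add_le _ _).trans le_rfl) le_rfl)) le_rfl)
    _ ≤ (2 * r * d₁ + (0 + 3 * r) * ((1 + 2 * r) * d₁)) + (2 * r * d₂ + (r + 2 * r) * ((1 + 2 * r) * d₂))
          + (2 * r * d₃ + (2 * r + r) * ((1 + 2 * r) * d₃)) + (2 * r * d₄ + (3 * r + 0) * ((1 + 2 * r) * d₄)) :=
        add_le_add (add_le_add (add_le_add t₁ t₂) t₃) t₄
    _ = (5 * r + 6 * r ^ 2) * (d₁ + d₂ + d₃ + d₄) := by ring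
    _ ≤ 11 * r * (d₁ + d₂ + d₃ + d₄) := by
        have h1 : r ^ 2 ≤ r := by rw [sq]; exact mul_le_of_le_one_left hr0 hr1
        have hsum : 0 ≤ d₁ + d₂ + d₃ + d₄ := by positivity
        exact mul_le_mul_of_nonneg_right (by linarith) hsum

end Plaq4

end Summit.QuantumFields.YangMills.Theorems.Prop7ExpLipschitz

end
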